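import Summits.BirchSwinnertonDyer.BirchSwinnertonDyer.Theses.SignedBaseChange
import Summits.BirchSwinnertonDyer.BirchSwinnertonDyer.Theorems.SignedBaseChangeTwistPairGreenbergProductDivisibilitySplitRationalAnchorGlue
import Summits.BirchSwinnertonDyer.Rank1Residual.Supersingular.KobayashiMainConjectureX7
import Summits.BirchSwinnertonDyer.Rank1Residual.Supersingular.TwistStability
import Literature.NumberTheory.EllipticCurves.BurungaleSkinnerTianWan2024.GreenbergBDPComparisonSupersingularPRE
import Literature.NumberTheory.EllipticCurves.BurungaleCastellaSkinner2025.BDPMainConjecture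

/-!
# SignedBaseChange — rev 17-SS glue: K1″ from the SUPERSINGULAR-RESTRICTED rational children (helper `--supports` K1″
# stmt-BirchSwinnertonDyer-20519; tenure planner bsd-wall-ss g7)

The route's rung `WAllCornerX7FiveLe` only ever meets primes `p ≥ 5` of good SUPERSINGULAR reduction (`ClassX7 W p`,
so `a_p(W) = 0` by Hasse, `Rank1Residual.Supersingular.ClassX7.frobeniusTrace_eq_zero_of_five_le`), and the auxiliary
twist `W' = W^(d)` of K1″'s frame data (`…CanonicalFrameData.stub_frameDataBCSsplit_canonical`: `d` square-free, `p ∤ d`)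
is again supersingular at `p` (`Rank1Residual.Supersingular.frobeniusTrace_of_smul_eq_quadraticTwist`: `a_p(W') = (d/p)·a_p(W)`).
Hence the two RATIONAL children of K1″ (line `acanchor` v3, lead sbc-p1 g5; rev 16-RAT′ texts, T11 shape) may be restricted to
`W.frobeniusTrace p = 0` — a PURE WEAKENING (§3) that deletes their ordinary slice (which is print: Yan–Zhu 2026 Thms 4.2/4.7/3.3,
BCS 2025 Thm 1.2.4) — and the anticyclotomic child may additionally take as antecedents the two typed named facts its line `bdpline`
consumes at a supersingular prime (BSTW 2024 Prop. 6.27(i) PRE = `prop627_span_minus_eq_span_bdp_supersingular_PRE`, landed p551901;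
BCS 2025 Prop. 4.2.2 existence half = `prop422_exists_isBDPLFunction_mu_eq_zero`), which enter K1″'s split as two cite-only siblings.
§1 is the lead's composition `SignedBaseChangeK1RationalAnchor.twistPairGreenbergProductDivisibilityCanonical_of_esRat_of_acUnit_of_acDivRat`
(p544101 §3) made POINTWISE with `a_p = 0` threaded to both members of the twist pair; §2 is the rev-16-RAT′ T11 threading of
`SignedBaseChangeRev16Glue` (p546045) over §1. (That the rev-16-RAT′ texts imply the rev-17-SS texts is
certified separately: HOME/bsd-wall-ss/rev17-SS/Sketch24Weakening.lean.)
Nothing here asserts any child, K1″, or the named facts. No new definitions.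
-/

-- D-0017: single-problem summit, the namespace repeats the problem name by design.
set_option linter.dupNamespace false
set_option autoImplicit false

open scoped BigOperators Topology Manifold Classical MeasureTheory ProbabilityTheory Matrix InnerProductSpace ComplexConjugate ContinuousMap
open Filter Set Function TopologicalSpace MeasureTheory
open Literature

namespace Summit.BirchSwinnertonDyer.BirchSwinnertonDyer.Theorems.SignedBaseChangeRev17Glue

open Summit.BirchSwinnertonDyer.BirchSwinnertonDyer.Theses.SignedBaseChange
open Literature.NumberTheory.EllipticCurves Literature.NumberTheory.EllipticCurves.ModularForms
  Literature.NumberTheory.EllipticCurves.BurungaleSkinnerTianWan2024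
  Literature.NumberTheory.GaloisRepresentations
  Summit.BirchSwinnertonDyer.BirchSwinnertonDyer.Theorems.SignedBaseChangeK1Acanchor
  Summit.BirchSwinnertonDyer.BirchSwinnertonDyer.Theorems.SignedBaseChangeK1RationalAnchor

/-! ## §1 K1″-body ⇐ ES-rat-SS ∧ ACunit ∧ ACdiv-rat-SS, pointwise (p544101 §3 with `a_p = 0` threaded) -/

/-- **K1″ (body after `SignedTwoVariableInputs →`, K1can.sig VERBATIM) ⇐ the supersingular-restricted unguarded rational hypotheses**:
ES-rat and ACdiv-rat asked only at primes with `W.frobeniusTrace p = 0`; ACunit (`μ(G⁻) = 0`) as in p544101. Proof = p544101 §3 with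
`a_p(W) = 0` (Hasse on X7, `p ≥ 5`) and `a_p(W') = 0` (twisting formula, `p ∤ 2d`) supplied at the six application sites.
[cite: BurungaleCastellaSkinner2025, Prop. 5.2.1 (arXiv:2405.00270v2)] [cite: RubinSilverberg2002, §1] -/
theorem k1canonicalBody_of_esRatSS_of_acUnit_of_acDivRatSS
    (hESr : Literature.NumberTheory.EllipticCurves.ModularForms.nonempty_modularParametrizationData → ∀ (W : WeierstrassCurve ℚ) [W.IsElliptic] [W.IsGloballyMinimal] (p : ℕ) [Fact p.Prime], 5 ≤ p → W.HasGoodReductionAtPrime p → W.frobeniusTrace p = 0 → Literature.NumberTheory.EllipticCurves.Rank1Residual.Surj W p → ∀ (K : Type) [Field K] [NumberField K] (ι : PadicAlgCl p ≃+* ℂ) (v vbar : IsDedekindDomain.HeightOneSpectrum (NumberField.RingOfIntegers K)) (κ₁ κ₂ : ZpExtension K p) (γ₁ γ₂ : Field.absoluteGaloisGroup K) [Fact (ZpExtension.IsTopGeneratorPair κ₁ κ₂ γ₁ γ₂)] [NeZero (NumberField.discr K).natAbs] (N : ℕ) [NeZero N] (f : CuspForm (CongruenceSubgroup.Gamma0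 N) 2), IsNewformOf W f → (N : ℤ) = W.conductorNorm ℤ → IsImaginaryQuadratic K → ((Ideal.span {(p : ℤ)}).primesOver (NumberField.RingOfIntegers K)).ncard = 2 → ((p : ℕ) : NumberField.RingOfIntegers K) ∈ v.asIdeal → ((p : ℕ) : NumberField.RingOfIntegers K) ∈ vbar.asIdeal → vbar ≠ v → (∀ (w : NumberField.InfinitePlace K) (k : NumberField.RingOfIntegers K), k ∈ v.asIdeal ↔ ‖ι.symm (w.embedding (k : K))‖ < 1) → IsCoprime (N : ℤ) (NumberField.discr K) → (∀ ℓ : ℕ, ℓ.Prime → ℓ ∣ N → ((Ideal.span {(ℓ : ℤ)}).primesOver (NumberField.RingOfIntegers K)).ncard = 2) → Odd (NumberField.discr K) → NumberField.discr K ≠ -3 → κ₁.IsCyclotomic → κ₂.IsAnticyclotomic → ∀ (Ω δ : ℂ) (Ωp : (unrIntegers p)ˣ) (LK G : PowerSeries (PowerSeries (PadicComplexInt p))), Ω ≠ 0 → (δ ^ 2 = (NumberField.discr K : ℂ) ∨ δ ^ 2 = -(NumberField.discr K : ℂ)) → IsKatzMeasure₂ ι v vbar ∅ κ₁ κ₂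 γ₁⁻¹ γ₂⁻¹ 1 Ω δ ((Ωp : unrIntegers p) : PadicComplex p) LK → IsGreenbergLFunctionAnyRoot₂ ι v vbar κ₁ κ₂ γ₁⁻¹ γ₂⁻¹ f (NumberField.discr K).natAbs (NumberField.classNumber K) LK G → ∀ J : ℤ_[p] →+* PadicComplexInt p, (∀ x : ℤ_[p], ((J x : PadicComplexInt p) : PadicComplex p) = ((x : ℚ_[p]) : PadicComplex p)) → ∃ a : ℕ, PowerSeries.C (PowerSeries.C (((p : ℕ) : PadicComplexInt p) ^ a)) * G ∈ (WeierstrassCurve.XGr₂.charIdeal (W.baseChange K) p κ₁ κ₂ vbar γ₁ γ₂).map (IwasawaAlgebra₂.toUnr₂ p J))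
    (hUC : Literature.NumberTheory.EllipticCurves.ModularForms.nonempty_modularParametrizationData → ∀ (W : WeierstrassCurve ℚ) [W.IsElliptic] [W.IsGloballyMinimal] (p : ℕ) [Fact p.Prime], 5 ≤ p → W.HasGoodReductionAtPrime p → Literature.NumberTheory.EllipticCurves.Rank1Residual.Surj W p → ∀ (K : Type) [Field K] [NumberField K] (ι : PadicAlgCl p ≃+* ℂ) (v vbar : IsDedekindDomain.HeightOneSpectrum (NumberField.RingOfIntegers K)) (κ₁ κ₂ : ZpExtension K p) (γ₁ γ₂ : Field.absoluteGaloisGroup K) [Fact (ZpExtension.IsTopGeneratorPair κ₁ κ₂ γ₁ γ₂)] [NeZero (NumberField.discr K).natAbs] (N : ℕ) [NeZero N] (f : CuspForm (CongruenceSubgroup.Gamma0 N) 2), IsNewformOf W f → (N : ℤ) = W.conductorNorm ℤ → IsImaginaryQuadratic K → ((Ideal.span {(p : ℤ)}).primesOver (NumberField.RingOfIntegers K)).ncard = 2 → ((p : ℕ) : NumberField.RingOfIntegers K) ∈ v.asIdeal → ((p : ℕ) : NumberField.RingOfIntegers K) ∈ vbar.asIdeal → vbar ≠ v → (∀ (w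 : NumberField.InfinitePlace K) (k : NumberField.RingOfIntegers K), k ∈ v.asIdeal ↔ ‖ι.symm (w.embedding (k : K))‖ < 1) → IsCoprime (N : ℤ) (NumberField.discr K) → (∀ ℓ : ℕ, ℓ.Prime → ℓ ∣ N → ((Ideal.span {(ℓ : ℤ)}).primesOver (NumberField.RingOfIntegers K)).ncard = 2) → Odd (NumberField.discr K) → NumberField.discr K ≠ -3 → κ₁.IsCyclotomic → κ₂.IsAnticyclotomic → ∀ (Ω δ : ℂ) (Ωp : (unrIntegers p)ˣ) (LK G : PowerSeries (PowerSeries (PadicComplexInt p))), Ω ≠ 0 → (δ ^ 2 = (NumberField.discr K : ℂ) ∨ δ ^ 2 = -(NumberField.discr K : ℂ)) → IsKatzMeasure₂ ι v vbar ∅ κ₁ κ₂ γ₁⁻¹ γ₂⁻¹ 1 Ω δ ((Ωp : unrIntegers p) : PadicComplex p) LK → IsGreenbergLFunctionAnyRoot₂ ι v vbar κ₁ κ₂ γ₁⁻¹ γ₂⁻¹ f (NumberField.discr K).natAbs (NumberField.classNumber K) LK G → ∀ J : ℤ_[p] →+* PadicComplexInt p, (∀ x : ℤ_[p], ((J x :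 PadicComplexInt p) : PadicComplex p) = ((x : ℚ_[p]) : PadicComplex p)) → Literature.NumberTheory.EllipticCurves.GreenbergVatsal2000.HasUnitContent (UnrSeries₂.minus G))
    (hACr : Literature.NumberTheory.EllipticCurves.ModularForms.nonempty_modularParametrizationData → ∀ (W : WeierstrassCurve ℚ) [W.IsElliptic] [W.IsGloballyMinimal] (p : ℕ) [Fact p.Prime], 5 ≤ p → W.HasGoodReductionAtPrime p → W.frobeniusTrace p = 0 → Literature.NumberTheory.EllipticCurves.Rank1Residual.Surj W p → ∀ (K : Type) [Field K] [NumberField K] (ι : PadicAlgCl p ≃+* ℂ) (v vbar : IsDedekindDomain.HeightOneSpectrum (NumberField.RingOfIntegers K)) (κ₁ κ₂ : ZpExtension K p) (γ₁ γ₂ : Field.absoluteGaloisGroup K) [Fact (ZpExtension.IsTopGeneratorPair κ₁ κ₂ γ₁ γ₂)] [NeZero (NumberField.discr K).natAbs] (N : ℕ) [NeZero N] (f : CuspForm (CongruenceSubgroup.Gamma0 N) 2), IsNewformOf W f → (N : ℤ) = W.conductorNorm ℤ → IsImaginaryQuadratic K → ((Ideal.span {(p : ℤ)}).primesOver (NumberField.RingOfIntegers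 K)).ncard = 2 → ((p : ℕ) : NumberField.RingOfIntegers K) ∈ v.asIdeal → ((p : ℕ) : NumberField.RingOfIntegers K) ∈ vbar.asIdeal → vbar ≠ v → (∀ (w : NumberField.InfinitePlace K) (k : NumberField.RingOfIntegers K), k ∈ v.asIdeal ↔ ‖ι.symm (w.embedding (k : K))‖ < 1) → IsCoprime (N : ℤ) (NumberField.discr K) → (∀ ℓ : ℕ, ℓ.Prime → ℓ ∣ N → ((Ideal.span {(ℓ : ℤ)}).primesOver (NumberField.RingOfIntegers K)).ncard = 2) → Odd (NumberField.discr K) → NumberField.discr K ≠ -3 → κ₁.IsCyclotomic → κ₂.IsAnticyclotomic → ∀ (Ω δ : ℂ) (Ωp : (unrIntegers p)ˣ) (LK G : PowerSeries (PowerSeries (PadicComplexInt p))), Ω ≠ 0 → (δ ^ 2 = (NumberField.discr K : ℂ) ∨ δ ^ 2 = -(NumberField.discr K : ℂ)) → IsKatzMeasure₂ ι v vbar ∅ κ₁ κ₂ γ₁⁻¹ γ₂⁻¹ 1 Ω δ ((Ωp : unrIntegers p) : PadicComplex p) LK → IsGreenbergLFunctionAnyRoot₂ ι v vbar κ₁ κ₂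 γ₁⁻¹ γ₂⁻¹ f (NumberField.discr K).natAbs (NumberField.classNumber K) LK G → ∀ J : ℤ_[p] →+* PadicComplexInt p, (∀ x : ℤ_[p], ((J x : PadicComplexInt p) : PadicComplex p) = ((x : ℚ_[p]) : PadicComplex p)) → ∃ b : ℕ, ∀ x ∈ ((WeierstrassCurve.XGr₂.charIdeal (W.baseChange K) p κ₁ κ₂ vbar γ₁ γ₂).map (IwasawaAlgebra₂.toUnr₂ p J)).map (PowerSeries.constantCoeff (R := PowerSeries (PadicComplexInt p))), PowerSeries.C (((p : ℕ) : PadicComplexInt p) ^ b) * x ∈ Ideal.span {UnrSeries₂.minus G}) :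
    Literature.NumberTheory.EllipticCurves.ModularForms.nonempty_modularParametrizationData → ∀ (W : WeierstrassCurve ℚ) [W.IsElliptic] [W.IsGloballyMinimal] (p : ℕ) [Fact p.Prime], 5 ≤ p → Literature.NumberTheory.EllipticCurves.Rank1Residual.ClassX7 W p → Literature.NumberTheory.EllipticCurves.Rank1Residual.Surj W p → ∃ (K : Type) (_ : Field K) (_ : NumberField K) (ι : PadicAlgCl p ≃+* ℂ) (v vbar : IsDedekindDomain.HeightOneSpectrum (NumberField.RingOfIntegers K)) (κ₁ κ₂ : Literature.NumberTheory.EllipticCurves.ZpExtension K p) (γ₁ γ₂ : Field.absoluteGaloisGroup K) (_ : Fact (Literature.NumberTheory.EllipticCurves.ZpExtension.IsTopGeneratorPair κ₁ κ₂ γ₁ γ₂)) (_ : NeZero (NumberField.discr K).natAbs) (N : ℕ) (_ : NeZero N) (f : CuspForm (CongruenceSubgroup.Gamma0 N) 2) (d : ℤ) (W' : WeierstrassCurve ℚ) (_ : W'.IsElliptic) (_ : W'.IsGloballyMinimal) (C : WeierstrassCurve.VariableChange ℚ) (N' : ℕ) (_ : NeZero N') (f' : CuspForm (CongruenceSubgroup.Gamma0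 N') 2), Literature.NumberTheory.EllipticCurves.ModularForms.IsNewformOf W f ∧ (N : ℤ) = W.conductorNorm ℤ ∧ Literature.NumberTheory.EllipticCurves.ModularForms.IsNewformOf W' f' ∧ (N' : ℤ) = W'.conductorNorm ℤ ∧ Squarefree d ∧ 1 < d ∧ (∀ q : ℕ, q.Prime → Literature.NumberTheory.EllipticCurves.BurungaleSkinnerTianWan2024.RamifiedInQuadratic d q → q ≠ p ∧ ¬ q ∣ N ∧ ¬ (q : ℤ) ∣ NumberField.discr K) ∧ C • W' = W.quadraticTwist (d : ℚ) ∧ Literature.NumberTheory.EllipticCurves.IsImaginaryQuadratic K ∧ ((Ideal.span {(p : ℤ)}).primesOver (NumberField.RingOfIntegers K)).ncard = 2 ∧ ((p : ℕ) : NumberField.RingOfIntegers K) ∈ v.asIdeal ∧ ((p : ℕ) : NumberField.RingOfIntegers K) ∈ vbar.asIdeal ∧ vbar ≠ v ∧ (∀ (w : NumberField.InfinitePlace K) (k : NumberField.RingOfIntegers K), k ∈ v.asIdeal ↔ ‖ι.symm (w.embedding (k : K))‖ < 1) ∧ IsCoprime (N : ℤ) (NumberField.discr K) ∧ (∀ ℓ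 : ℕ, ℓ.Prime → ℓ ∣ N → ((Ideal.span {(ℓ : ℤ)}).primesOver (NumberField.RingOfIntegers K)).ncard = 2) ∧ (∀ ℓ : ℕ, ℓ.Prime → (ℓ : ℤ) ∣ d → ((Ideal.span {(ℓ : ℤ)}).primesOver (NumberField.RingOfIntegers K)).ncard = 2) ∧ ((Ideal.span {(2 : ℤ)}).primesOver (NumberField.RingOfIntegers K)).ncard = 2 ∧ (∀ ρ : Literature.NumberTheory.GaloisRepresentations.ModPGaloisRep K (ZMod p) 2, (W.baseChange K).IsTorsionGaloisRep p ρ → Literature.NumberTheory.GaloisRepresentations.FramedRep.IsAbsolutelyIrreducible ρ) ∧ κ₁.IsCyclotomic ∧ κ₂.IsAnticyclotomic ∧ (∃ ζ : ℤ_[p]ˣ, IsOfFinOrder ζ ∧ ((Literature.NumberTheory.GaloisRepresentations.GaloisRep.cyclotomicCharacter K p γ₁ * ζ : ℤ_[p]ˣ) : ℤ_[p]) = (Literature.NumberTheory.EllipticCurves.cyclotomicGenerator p : ℤ_[p])) ∧ ∀ (Ω δ : ℂ) (Ωp : (Literature.NumberTheory.EllipticCurves.unrIntegers p)ˣ) (LK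 G G' : PowerSeries (PowerSeries (PadicComplexInt p))), Ω ≠ 0 → (δ ^ 2 = (NumberField.discr K : ℂ) ∨ δ ^ 2 = -(NumberField.discr K : ℂ)) → Literature.NumberTheory.EllipticCurves.IsKatzMeasure₂ ι v vbar ∅ κ₁ κ₂ γ₁⁻¹ γ₂⁻¹ 1 Ω δ ((Ωp : Literature.NumberTheory.EllipticCurves.unrIntegers p) : PadicComplex p) LK → Literature.NumberTheory.EllipticCurves.IsGreenbergLFunctionAnyRoot₂ ι v vbar κ₁ κ₂ γ₁⁻¹ γ₂⁻¹ f (NumberField.discr K).natAbs (NumberField.classNumber K) LK G → Literature.NumberTheory.EllipticCurves.IsGreenbergLFunctionAnyRoot₂ ι v vbar κ₁ κ₂ γ₁⁻¹ γ₂⁻¹ f' (NumberField.discr K).natAbs (NumberField.classNumber K) LK G' → ∀ J : ℤ_[p] →+* PadicComplexInt p, (∀ x : ℤ_[p], ((J x : PadicComplexInt p) : PadicComplex p) = ((x : ℚ_[p]) : PadicComplex p)) → ∃ s : PowerSeries (PadicComplexInt p), s ≠ 0 ∧ Ideal.span {PowerSeries.map (PowerSeries.C (R := PadicComplexInt p))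 s} * ((WeierstrassCurve.XGr₂.charIdeal (W.baseChange K) p κ₁ κ₂ vbar γ₁ γ₂).map (Literature.NumberTheory.EllipticCurves.IwasawaAlgebra₂.toUnr₂ p J) * (WeierstrassCurve.XGr₂.charIdeal (W'.baseChange K) p κ₁ κ₂ vbar γ₁ γ₂).map (Literature.NumberTheory.EllipticCurves.IwasawaAlgebra₂.toUnr₂ p J)) ≤ Ideal.span {G * G'} := by
  intro hmodP W _ _ p _ hp hX hs
  obtain ⟨K, iF, iNF, ι, v, vbar, κ₁, κ₂, γ₁, γ₂, iPair, iD, N, iN, f, d, W', iE', iM', C, N', iN', f',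
      h0, h1, h2, h3, h4, h5, h6, h7, h8, h9, h10, h11, h12, h13, h14, h15, h16, h17, hcan,
      e1, e2, e3, e4, e5, e6, e7⟩ :=
    Summit.BirchSwinnertonDyer.BirchSwinnertonDyer.Theorems.SignedBaseChangeK1FrameDataCanonical.stub_frameDataBCSsplit_canonical
      hmodP W p hp hX hs
  have hgood : W.HasGoodReductionAtPrime p := hX.1.1
  have hgood' : W'.HasGoodReductionAtPrime p :=
    Summit.BirchSwinnertonDyer.BirchSwinnertonDyer.Theorems.SignedBaseChangeK2RFrames.hasGoodReductionAtPrime_of_smul_eq_quadraticTwist_of_not_ramifiedInQuadratic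
      W W' h7 Fact.out hgood (fun hr ↦ (h6 p Fact.out hr).1 rfl)
  -- supersingularity of both members of the twist pair (the one addition to p544101 §3)
  have hap : W.frobeniusTrace p = 0 :=
    Summit.BirchSwinnertonDyer.Rank1Residual.Supersingular.ClassX7.frobeniusTrace_eq_zero_of_five_le W p hp hX
  have hp2d : ¬ (p : ℤ) ∣ 2 * d := by
    intro h
    rcases (Nat.prime_iff_prime_int.mp Fact.out).dvd_or_dvd h with h2 | hd
    · have h2' : p ∣ 2 := by exact_mod_cast h2
      have := Nat.le_of_dvd two_pos h2'
      omega
    · haveI : NeZero p := ⟨(Fact.out : p.Prime).ne_zero⟩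
      exact e6.1 ((ZMod.intCast_zmod_eq_zero_iff_dvd d p).mpr hd)
  have hap' : W'.frobeniusTrace p = 0 := by
    rw [Summit.BirchSwinnertonDyer.Rank1Residual.Supersingular.frobeniusTrace_of_smul_eq_quadraticTwist W W' p h4 h7 hp2d
      hgood, hap, mul_zero]
  have hs' : Literature.NumberTheory.EllipticCurves.Rank1Residual.Surj W' p :=
    surj_of_smul_eq_quadraticTwist W W' p h5 h7 hs
  have h14' : IsCoprime (N' : ℤ) (NumberField.discr K) :=
    Summit.BirchSwinnertonDyer.BirchSwinnertonDyer.Theorems.SignedBaseChangeK2RFrames.isCoprime_conductorNorm_twist_discr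
      W W' h7 h1 h3 (fun q hq hr ↦ ⟨(h6 q hq hr).2.1, (h6 q hq hr).2.2⟩) h14
  have e1' := heegner_twist W W' h7 h1 h3 (K := K) e1 e5 e2
  refine ⟨K, iF, iNF, ι, v, vbar, κ₁, κ₂, γ₁, γ₂, iPair, iD, N, iN, f, d, W', iE', iM', C, N', iN', f',
    h0, h1, h2, h3, h4, h5, h6, h7, h8, h9, h10, h11, h12, h13, h14, e1, e5, e2, h15, h16, h17, hcan, ?_⟩
  intro Ω δ Ωp LK G G' hΩ hδ hLK hG hG' J hJ
  have hA : (WeierstrassCurve.XGr₂.charIdeal (W.baseChange K) p κ₁ κ₂ vbar γ₁ γ₂).map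
      (IwasawaAlgebra₂.toUnr₂ p J) ≤ Ideal.span {G} :=
    map_le_span_of_rational_anchor (charIdealIsPrincipal₂ p _) J (hUC hmodP W p hp hgood hs K ι v vbar κ₁ κ₂ γ₁ γ₂ N f h0 h1 h8 h9 h10 h11 h12 h13 h14 e1 e3.1 e3.2 h16 h17 Ω δ Ωp LK G hΩ hδ hLK hG J hJ)
      (hESr hmodP W p hp hgood hap hs K ι v vbar κ₁ κ₂ γ₁ γ₂ N f h0 h1 h8 h9 h10 h11 h12 h13 h14 e1 e3.1 e3.2 h16 h17 Ω δ Ωp LK G hΩ hδ hLK hG J hJ)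
      (hACr hmodP W p hp hgood hap hs K ι v vbar κ₁ κ₂ γ₁ γ₂ N f h0 h1 h8 h9 h10 h11 h12 h13 h14 e1 e3.1 e3.2 h16 h17 Ω δ Ωp LK G hΩ hδ hLK hG J hJ)
  have hB : (WeierstrassCurve.XGr₂.charIdeal (W'.baseChange K) p κ₁ κ₂ vbar γ₁ γ₂).map
      (IwasawaAlgebra₂.toUnr₂ p J) ≤ Ideal.span {G'} :=
    map_le_span_of_rational_anchor (charIdealIsPrincipal₂ p _) J (hUC hmodP W' p hp hgood' hs' K ι v vbar κ₁ κ₂ γ₁ γ₂ N' f' h2 h3 h8 h9 h10 h11 h12 h13 h14' e1' e3.1 e3.2 h16 h17 Ω δ Ωp LK G' hΩ hδ hLK hG' J hJ)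
      (hESr hmodP W' p hp hgood' hap' hs' K ι v vbar κ₁ κ₂ γ₁ γ₂ N' f' h2 h3 h8 h9 h10 h11 h12 h13 h14' e1' e3.1 e3.2 h16 h17 Ω δ Ωp LK G' hΩ hδ hLK hG' J hJ)
      (hACr hmodP W' p hp hgood' hap' hs' K ι v vbar κ₁ κ₂ γ₁ γ₂ N' f' h2 h3 h8 h9 h10 h11 h12 h13 h14' e1' e3.1 e3.2 h16 h17 Ω δ Ωp LK G' hΩ hδ hLK hG' J hJ)
  exact ⟨1, one_ne_zero, span_C_one_mul_mul_le hA hB⟩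

/-! ## §2 The glue over the rev-17-SS children texts (VERBATIM = children-ratSS.json) -/

/-- **rev 17-SS glue: K1″ `TwistPairGreenbergProductDivisibilityCanonical` ⇐ ACdiv-rat-SS child ∧ ES-rat-SS child ∧ the two cite-only
siblings** (BSTW 2024 Prop. 6.27(i) PRE; BCS 2025 Prop. 4.2.2 existence half). T11 threading as in `SignedBaseChangeRev16Glue`
(torsion for the ACdiv child supplied by the ES child's first conjunct); the μ-input is `SignedTwoVariableInputs.1` via
`acUnitContent_of_prop422`. This is the theorem the resplit's glue item `TwistPairCanonicalRatSSGlue` is closed by.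
[cite: BurungaleCastellaSkinner2025, Prop. 4.2.2 and Prop. 5.2.1 (arXiv:2405.00270v2)]
[cite: BurungaleSkinnerTianWan2024, Prop. 6.27 (i) (arXiv:2409.01350v2), OPEN binder — used only as a hypothesis] -/
theorem twistPairGreenbergProductDivisibilityCanonical_of_ratSSChildren
    (hD : Literature.NumberTheory.EllipticCurves.BurungaleSkinnerTianWan2024.prop627_span_minus_eq_span_bdp_supersingular_PRE → Literature.NumberTheory.EllipticCurves.BurungaleCastellaSkinner2025.prop422_exists_isBDPLFunction_mu_eq_zero → (Literature.NumberTheory.EllipticCurves.BurungaleCastellaSkinner2025.prop422_greenbergAnyRoot_hasUnitContent_minus ∧ Literature.NumberTheory.EllipticCurves.BurungaleSkinnerTianWan2024.props118_27_519_exists_signedTwoVariablePackage_supersingular_PRE) → Literature.NumberTheory.EllipticCurves.ModularForms.nonempty_modularParametrizationData → ∀ (W : WeierstrassCurve ℚ) [W.IsElliptic] [W.IsGloballyMinimal] (p : ℕ) [Fact p.Prime], 5 ≤ p → W.HasGoodReductionAtPrime p → W.frobeniusTrace p = 0 → Literature.NumberTheory.EllipticCurves.Rank1Residual.Surj W p →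 ∀ (K : Type) [Field K] [NumberField K] (ι : PadicAlgCl p ≃+* ℂ) (v vbar : IsDedekindDomain.HeightOneSpectrum (NumberField.RingOfIntegers K)) (κ₁ κ₂ : Literature.NumberTheory.EllipticCurves.ZpExtension K p) (γ₁ γ₂ : Field.absoluteGaloisGroup K) [Fact (Literature.NumberTheory.EllipticCurves.ZpExtension.IsTopGeneratorPair κ₁ κ₂ γ₁ γ₂)] [NeZero (NumberField.discr K).natAbs] (N : ℕ) [NeZero N] (f : CuspForm (CongruenceSubgroup.Gamma0 N) 2), Literature.NumberTheory.EllipticCurves.ModularForms.IsNewformOf W f → (N : ℤ) = W.conductorNorm ℤ → Literature.NumberTheory.EllipticCurves.IsImaginaryQuadratic K → ((Ideal.span {(p : ℤ)}).primesOver (NumberField.RingOfIntegers K)).ncard = 2 → ((p : ℕ) : NumberField.RingOfIntegers K) ∈ v.asIdeal → ((p : ℕ) : NumberField.RingOfIntegers K) ∈ vbar.asIdeal → vbar ≠ v → (∀ (w : NumberField.InfinitePlace K) (k : NumberField.RingOfIntegers K), k ∈ v.asIdeal ↔ ‖ι.symm (w.embedding (k : K))‖ < 1) → IsCoprime (N :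 ℤ) (NumberField.discr K) → (∀ ℓ : ℕ, ℓ.Prime → ℓ ∣ N → ((Ideal.span {(ℓ : ℤ)}).primesOver (NumberField.RingOfIntegers K)).ncard = 2) → Odd (NumberField.discr K) → NumberField.discr K ≠ -3 → κ₁.IsCyclotomic → κ₂.IsAnticyclotomic → ∀ (Ω δ : ℂ) (Ωp : (Literature.NumberTheory.EllipticCurves.unrIntegers p)ˣ) (LK G : PowerSeries (PowerSeries (PadicComplexInt p))), Ω ≠ 0 → (δ ^ 2 = (NumberField.discr K : ℂ) ∨ δ ^ 2 = -(NumberField.discr K : ℂ)) → Literature.NumberTheory.EllipticCurves.IsKatzMeasure₂ ι v vbar ∅ κ₁ κ₂ γ₁⁻¹ γ₂⁻¹ 1 Ω δ ((Ωp : Literature.NumberTheory.EllipticCurves.unrIntegers p) : PadicComplex p) LK → Literature.NumberTheory.EllipticCurves.IsGreenbergLFunctionAnyRoot₂ ι v vbar κ₁ κ₂ γ₁⁻¹ γ₂⁻¹ f (NumberField.discr K).natAbs (NumberField.classNumber K) LK G → ∀ J : ℤ_[p] →+* PadicComplexInt p, (∀ x : ℤ_[p], ((J x : PadicComplexInt p)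 : PadicComplex p) = ((x : ℚ_[p]) : PadicComplex p)) → Module.IsTorsion (Literature.NumberTheory.EllipticCurves.IwasawaAlgebra₂ p) ((W.baseChange K).XGr₂ p κ₁ κ₂ vbar γ₁ γ₂) → ∃ b : ℕ, ∀ x ∈ ((WeierstrassCurve.XGr₂.charIdeal (W.baseChange K) p κ₁ κ₂ vbar γ₁ γ₂).map (Literature.NumberTheory.EllipticCurves.IwasawaAlgebra₂.toUnr₂ p J)).map (PowerSeries.constantCoeff (R := PowerSeries (PadicComplexInt p))), PowerSeries.C (((p : ℕ) : PadicComplexInt p) ^ b) * x ∈ Ideal.span {Literature.NumberTheory.EllipticCurves.UnrSeries₂.minus G})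
    (hE : (Literature.NumberTheory.EllipticCurves.BurungaleCastellaSkinner2025.prop422_greenbergAnyRoot_hasUnitContent_minus ∧ Literature.NumberTheory.EllipticCurves.BurungaleSkinnerTianWan2024.props118_27_519_exists_signedTwoVariablePackage_supersingular_PRE) → Literature.NumberTheory.EllipticCurves.ModularForms.nonempty_modularParametrizationData → ∀ (W : WeierstrassCurve ℚ) [W.IsElliptic] [W.IsGloballyMinimal] (p : ℕ) [Fact p.Prime], 5 ≤ p → W.HasGoodReductionAtPrime p → W.frobeniusTrace p = 0 → Literature.NumberTheory.EllipticCurves.Rank1Residual.Surj W p → ∀ (K : Type) [Field K] [NumberField K] (ι : PadicAlgCl p ≃+* ℂ) (v vbar : IsDedekindDomain.HeightOneSpectrum (NumberField.RingOfIntegers K)) (κ₁ κ₂ : Literature.NumberTheory.EllipticCurves.ZpExtension K p) (γ₁ γ₂ : Field.absoluteGaloisGroup K) [Fact (Literature.NumberTheory.EllipticCurves.ZpExtension.IsTopGeneratorPair κ₁ κ₂ γ₁ γ₂)] [NeZero (NumberField.discr K).natAbs] (N : ℕ) [NeZero N] (f : CuspForm (CongruenceSubgroup.Gamma0 N) 2),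 Literature.NumberTheory.EllipticCurves.ModularForms.IsNewformOf W f → (N : ℤ) = W.conductorNorm ℤ → Literature.NumberTheory.EllipticCurves.IsImaginaryQuadratic K → ((Ideal.span {(p : ℤ)}).primesOver (NumberField.RingOfIntegers K)).ncard = 2 → ((p : ℕ) : NumberField.RingOfIntegers K) ∈ v.asIdeal → ((p : ℕ) : NumberField.RingOfIntegers K) ∈ vbar.asIdeal → vbar ≠ v → (∀ (w : NumberField.InfinitePlace K) (k : NumberField.RingOfIntegers K), k ∈ v.asIdeal ↔ ‖ι.symm (w.embedding (k : K))‖ < 1) → IsCoprime (N : ℤ) (NumberField.discr K) → (∀ ℓ : ℕ, ℓ.Prime → ℓ ∣ N → ((Ideal.span {(ℓ : ℤ)}).primesOver (NumberField.RingOfIntegers K)).ncard = 2) → Odd (NumberField.discr K) → NumberField.discr K ≠ -3 → κ₁.IsCyclotomic → κ₂.IsAnticyclotomic → ∀ (Ω δ : ℂ) (Ωp : (Literature.NumberTheory.EllipticCurves.unrIntegers p)ˣ) (LK G : PowerSeries (PowerSeries (PadicComplexInt p))), Ω ≠ 0 → (δ ^ 2 = (NumberField.discr K : ℂ) ∨ δ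 ^ 2 = -(NumberField.discr K : ℂ)) → Literature.NumberTheory.EllipticCurves.IsKatzMeasure₂ ι v vbar ∅ κ₁ κ₂ γ₁⁻¹ γ₂⁻¹ 1 Ω δ ((Ωp : Literature.NumberTheory.EllipticCurves.unrIntegers p) : PadicComplex p) LK → Literature.NumberTheory.EllipticCurves.IsGreenbergLFunctionAnyRoot₂ ι v vbar κ₁ κ₂ γ₁⁻¹ γ₂⁻¹ f (NumberField.discr K).natAbs (NumberField.classNumber K) LK G → ∀ J : ℤ_[p] →+* PadicComplexInt p, (∀ x : ℤ_[p], ((J x : PadicComplexInt p) : PadicComplex p) = ((x : ℚ_[p]) : PadicComplex p)) → Module.IsTorsion (Literature.NumberTheory.EllipticCurves.IwasawaAlgebra₂ p) ((W.baseChange K).XGr₂ p κ₁ κ₂ vbar γ₁ γ₂) ∧ ∃ a : ℕ, PowerSeries.C (PowerSeries.C (((p : ℕ) : PadicComplexInt p) ^ a)) * G ∈ (WeierstrassCurve.XGr₂.charIdeal (W.baseChange K) p κ₁ κ₂ vbar γ₁ γ₂).map (Literature.NumberTheory.EllipticCurves.IwasawaAlgebra₂.toUnr₂ p J))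
    (h627 : Literature.NumberTheory.EllipticCurves.BurungaleSkinnerTianWan2024.prop627_span_minus_eq_span_bdp_supersingular_PRE)
    (h422e : Literature.NumberTheory.EllipticCurves.BurungaleCastellaSkinner2025.prop422_exists_isBDPLFunction_mu_eq_zero) :
    TwistPairGreenbergProductDivisibilityCanonical := by
  intro hIn
  refine k1canonicalBody_of_esRatSS_of_acUnit_of_acDivRatSS ?_ (acUnitContent_of_prop422 hIn.1) ?_
  · intro hmod W _ _ p _ h5 hg hap hs K _ _ ι v vbar κ₁ κ₂ γ₁ γ₂ _ _ N _ f hf hN hK hsp hv hvb hne hι hcop hH hodd h3 hc ha Ω δ Ωp LK G hΩ hδ hKz hGr J hJ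
    exact (hE hIn hmod W p h5 hg hap hs K ι v vbar κ₁ κ₂ γ₁ γ₂ N f hf hN hK hsp hv hvb hne hι hcop hH hodd h3 hc ha Ω δ Ωp LK G hΩ hδ hKz hGr J hJ).2
  · intro hmod W _ _ p _ h5 hg hap hs K _ _ ι v vbar κ₁ κ₂ γ₁ γ₂ _ _ N _ f hf hN hK hsp hv hvb hne hι hcop hH hodd h3 hc ha Ω δ Ωp LK G hΩ hδ hKz hGr J hJ
    exact hD h627 h422e hIn hmod W p h5 hg hap hs K ι v vbar κ₁ κ₂ γ₁ γ₂ N f hf hN hK hsp hv hvb hne hι hcop hH hodd h3 hc ha Ω δ Ωp LK G hΩ hδ hKz hGr J hJ (hE hIn hmod W p h5 hg hap hs K ι v vbar κ₁ κ₂ γ₁ γ₂ N f hf hN hK hsp hv hvb hne hι hcop hH hodd h3 hc ha Ω δ Ωp LK G hΩ hδ hKz hGr J hJ).1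

end Summit.BirchSwinnertonDyer.BirchSwinnertonDyer.Theorems.SignedBaseChangeRev17Glue
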